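import Summits.CriticalPhenomena.PercolationContinuityZ3.Theses.PercNearOneGluing
import Literature.Probability.Percolation.PercolationProofs
import Literature.Probability.Percolation.ConditionalPositiveAssociationProofs
import Literature.Probability.Percolation.TwoClusterConditionalAssociationProofs

/-! TTRL-lite variant V193 of stmt-CriticalPhenomena-4576

(`stub_goodStep`, move `small_case+small_case`: `n ≤ 2`, `A.card = 1`).  No new definitions,
no named facts. -/

namespace Summit.CriticalPhenomena.PercolationContinuityZ3.Theorems

open MeasureTheory Literature.Probability.LatticeModels Literature.Probability.Percolation
open scoped Classical BigOperators

/-- TTRL-lite variant V193 of `stub_goodStep` (stmt-CriticalPhenomena-4576): the inductive step of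
the good-quadruple inequality on at most two vertices with `A.card = 1`.  The hypotheses are
contradictory: `o ∉ A ∋ b` gives `o ≠ b`, and the low neighbour `y ∉ A`, `y ≠ o` would be a third
element of `Fin n` with `n ≤ 2`. -/
theorem stub_goodStep_var193 : ∀ (n : ℕ) (w : Sym2 (Fin n) → unitInterval) (A : Finset (Fin n)) (o b : Fin n), n ≤ 2 → A.card = 1 → b ∈ A → o ∉ A → (∃ y : Fin n, y ∉ A ∧ y ≠ o ∧ (w s(o, y) : ℝ) ≠ 0) → (∀ w' : Sym2 (Fin n) → unitInterval, (Finset.univ.filter (fun v : Fin n => ∃ u : Fin n, 0 < (w' s(u, v) : ℝ))).card < (Finset.univ.filter (fun v : Fin n => ∃ u : Fin n, 0 < (w s(u, v) : ℝ))).card → ∀ (A' : Finset (Fin n)) (o' b' : Fin n), b' ∈ A' → o' ∉ A' → ∀ (t : ℝ) (sel : Finset (Fin n) → Fin n), (∀ W, sel W ∈ A') → (∀ a ∈ A', 1 - t ≤ (prodBernoulli w').real (openConn a b')) → (prodBernoulli w').real ((⋃ a ∈ A', openConn o' a) ∩ (openConn o' b')ᶜ) + ∑ W ∈ (Finset.univ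 : Finset (Finset (Fin n))).filter (fun W => o' ∈ W ∧ Disjoint W A'), (prodBernoulli w').real {ω : BondConfig (Fin n) | openCluster ω o' = (W : Set (Fin n))} * (prodBernoulli w').real (openConnIn ((W : Set (Fin n))ᶜ) (sel W) b')ᶜ ≤ t) → ∀ (t : ℝ) (sel : Finset (Fin n) → Fin n), (∀ W, sel W ∈ A) → (∀ a ∈ A, 1 - t ≤ (prodBernoulli w).real (openConn a b)) → (prodBernoulli w).real ((⋃ a ∈ A, openConn o a) ∩ (openConn o b)ᶜ) + ∑ W ∈ (Finset.univ : Finset (Finset (Fin n))).filter (fun W => o ∈ W ∧ Disjoint W A), (prodBernoulli w).real {ω : BondConfig (Fin n) | openCluster ω o = (W : Set (Fin n))} * (prodBernoulli w).real (openConnIn ((W : Set (Fin n))ᶜ) (sel W) b)ᶜ ≤ t := by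
  intro n w A o b hn _hA hbA hoA hy _hIH t sel _hsel _hlev
  obtain ⟨y, hyA, hyo, _hw⟩ := hy
  exfalso
  have hob : o.val ≠ b.val := fun h => hoA (Fin.ext h ▸ hbA)
  have hyb : y.val ≠ b.val := fun h => hyA (Fin.ext h ▸ hbA)
  have hyo' : y.val ≠ o.val := fun h => hyo (Fin.ext h)
  have h1 := o.isLt
  have h2 := b.isLt
  have h3 := y.isLt
  omega

end Summit.CriticalPhenomena.PercolationContinuityZ3.Theorems
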